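import Summits.AtomisticToContinuum.HydrodynamicLimit.Theses.AntiMazurCoboundaries
import Literature.MathematicalPhysics.KineticTheory.HardSphereEulerProofs
import Literature.Analysis.FluidPDE.HardSphereAlexander
import Literature.Analysis.FluidPDE.HardSphereTorusMeasure

/-!
# `InfluenceLocality` (stmt-AtomisticToContinuum-13916) — certifying corrupted forecasts
without computing the dynamics

Sorry-free §F of the standing disprover's work file `Cruxes/InfluenceLocality/Disproof.lean`
(refuter-cdisprove-stmt-AtomisticToContinuum-13916-0, 2026-08-16): the crux unbundled
(`badCount`, `gibbs`; the companion file `Negative/KillCriterion.lean` has the quantifier shell),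
the explicit `alexanderFlow` structure (the tree's collision-by-collision flow with NAMED fields),
`localClusterState_of_isolated` (an isolated sphere is forecast by its free flight), and the
CERTIFICATION LEMMA `one_le_badCount_of_isolated_overlap`: two spheres isolated at the forecast
range whose free flights overlap inside the window force `#bad ≥ 1`, for ANY hard-sphere flow on
its good set (good orbits stay in the hard-sphere domain) — no dynamics is computed. The witness
event `AimedPairs` is measurable, `G_N(goodᶜ) = 0`, and `corruptionEvent_of_aimedPairs_mass`
reduces the dynamical fact `CorruptionEvent` (positive-probability corruption at fixed range,
the input showing that the slack `δ > 0` of the crux is load-bearing) to a STATIC lower bound on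
the `G_N`-mass of `AimedPairs`. Nothing here asserts a Theses decl positively.
-/

namespace Summit.AtomisticToContinuum.HydrodynamicLimit.Theorems.InfluenceLocality.Negative

open MeasureTheory Set
open scoped Classical ENNReal
open Literature.Analysis.FluidPDE Literature.MathematicalPhysics.KineticTheory
open Summit.AtomisticToContinuum.HydrodynamicLimit.Theses.AntiMazurCoboundaries (InfluenceLocality)

noncomputable section


/-- The microscopic length unit `ℓ_N = (N+1)^{-1/3}` (mean interparticle distance on the unit
torus with `N + 1` particles). [folklore] -/
abbrev ell (N : ℕ) : ℝ := ((N + 1 : ℕ) : ℝ) ^ (-(1 / 3 : ℝ))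

/-- The flows of the crux: a hard-sphere flow of `N + 1` spheres of diameter `σ ℓ_N` on `𝕋³`. [folklore] -/
abbrev Flow (σ : ℝ) (N : ℕ) : Type :=
  HardSphereFlow (Torus.geometry (Fin 3)) (hsDiameter σ N) (N + 1)

/-- The cluster-flow families of the crux (same diameter, every particle number). [folklore] -/
abbrev ClusterFlows (σ : ℝ) (N : ℕ) : Type :=
  (k : ℕ) → HardSphereFlow (Torus.geometry (Fin 3)) (hsDiameter σ N) k

/-- `#bad`: the number of particles whose true state differs from their range-`Rℓ` local forecast
at some time of the window `[0, Tℓ]` (verbatim the `Finset.card` of the crux). [folklore] -/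
def badCount (σ T R : ℝ) (N : ℕ) (Φ : Flow σ N) (Ψ : ClusterFlows σ N)
    (z : Config (N + 1) (Fin 3) T3) : ℕ :=
  (Finset.univ.filter fun i : Fin (N + 1) => ∃ t ∈ Set.Icc (0 : ℝ) (T * ell N),
      Φ.flow t z i ≠ localClusterState Ψ (R * ell N) t z i).card

/-- `G_N`: the global Gibbs law with constant profiles (verbatim the measure of the crux). [folklore] -/
def gibbs (σ a θ : ℝ) (u₀ : V3) (N : ℕ) (Φ : Flow σ N) : Measure (Config (N + 1) (Fin 3) T3) :=
  localGibbsLaw σ (fun _ => a) (fun _ => u₀) (fun _ => θ) N Φ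

/-- DYNAMICAL INPUT 1 (positive-probability corruption at fixed range): at reduced density `σ`,
horizon `T` and range `R` there are `p > 0` and `N₀` such that for every `N ≥ N₀` some flows and
some measurable event of `G_N`-mass `≥ p` carry at least one bad particle. Physically obvious (an
intruder from outside `B(x₀, Rℓ)` with speed `≈ 2R√θ/T` hits particle `0` while everything else
stays away; Maxwellian tails give `p ≈ c(σT)·(R/T)·e^{-2R²/T²} > 0` independent of `N`); see §(E)
for the formalisation plan and its cost. [folklore] -/
def CorruptionEvent (a θ : ℝ) (u₀ : V3) (σ T R : ℝ) : Prop :=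
  ∃ p : ℝ≥0∞, 0 < p ∧ ∃ N₀ : ℕ, ∀ N : ℕ, N₀ ≤ N → ∃ (Φ : Flow σ N) (Ψ : ClusterFlows σ N)
    (A : Set (Config (N + 1) (Fin 3) T3)), MeasurableSet A ∧
    (∀ z ∈ A, 1 ≤ badCount σ T R N Φ Ψ z) ∧ p ≤ gibbs σ a θ u₀ N Φ A

/-! ## (F) Certifying corruption WITHOUT computing the dynamics

Two spheres `i ≠ j`, each ISOLATED at time `0` (nobody within the forecast range `Rℓ`), whose
FREE flights overlap (`< ε` apart in the torus chart) at some time `t ∈ [0, Tℓ]`: then at least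
one of them is bad, for EVERY flow `Φ` (good orbits stay in the hard-sphere domain) and every
cluster family `Ψ` whose one-particle flow is free flight on an everywhere-good set (e.g. the
tree's Alexander flow, `alexanderFlow` below). This is the deterministic half of near-miss 1. -/

section Certification

/-- The tree's collision-by-collision (Alexander) flow on `𝕋³`, as a `HardSphereFlow` structure
with EXPLICIT fields (`HardSphereFlow.nonempty_torus_of_construction` only gives `Nonempty`). [folklore] -/
def alexanderFlow {ε : ℝ} (hε : 0 < ε) (hε' : ε < 2⁻¹) (k : ℕ) :
    HardSphereFlow (Torus.geometry (Fin 3)) ε k where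
  flow := Alexander.flow (Torus.geometry (Fin 3)) ε
  good := Alexander.good (Torus.geometry (Fin 3)) ε
  measurableSet_good := (Alexander.torusFlow_measurable_holds hε hε' k).1
  good_subset := Alexander.good_subset_hardSphereDomain
  measure_compl_good := Alexander.torusFlow_ae_good_holds hε hε' k
  mapsTo_good := (Alexander.torusFlow_group_holds hε hε' k).1
  flow_zero := (Alexander.torusFlow_group_holds hε hε' k).2.1
  flow_add := (Alexander.torusFlow_group_holds hε hε' k).2.2
  measurable_flow := (Alexander.torusFlow_measurable_holds hε hε' k).2
  isTrajectory := Alexander.torusFlow_isTrajectory_holds hε hε' k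
  measurePreserving := Alexander.torusFlow_measurePreserving_holds hε hε' k

/-- One sphere alone: the hard-sphere domain is everything. [folklore] -/
theorem hardSphereDomain_one (ε : ℝ) :
    hardSphereDomain (Torus.geometry (Fin 3)) 1 ε = (Set.univ : Set (Config 1 (Fin 3) T3)) := by
  ext z
  simp only [mem_hardSphereDomain, Set.mem_univ, iff_true]
  intro i j hij
  exact absurd (Subsingleton.elim i j) hij

/-- One sphere alone never collides. [folklore] -/
theorem freeExitTime_one (ε : ℝ) (w : Config 1 (Fin 3) T3) :
    Alexander.freeExitTime (Torus.geometry (Fin 3)) ε w = ∞ :=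
  Alexander.freeExitTime_eq_top_iff.2 fun t _ => by rw [hardSphereDomain_one]; exact Set.mem_univ _

/-- One sphere alone is forward-good. [folklore] -/
theorem fwdGood_one (ε : ℝ) (w : Config 1 (Fin 3) T3) :
    Alexander.FwdGood (Torus.geometry (Fin 3)) ε w :=
  ⟨fun _ hk => absurd (freeExitTime_one ε _) hk,
    fun _ _ _ _ i j hij => absurd (Subsingleton.elim i j) hij,
    ENNReal.tsum_eq_top_of_eq_top ⟨0, freeExitTime_one ε _⟩⟩

/-- One sphere alone: every datum is good for the Alexander flow. [folklore] -/
theorem alexander_good_one (ε : ℝ) :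
    Alexander.good (Torus.geometry (Fin 3)) ε = (Set.univ : Set (Config 1 (Fin 3) T3)) := by
  ext w
  simp only [Set.mem_univ, iff_true]
  refine ⟨by rw [hardSphereDomain_one]; exact Set.mem_univ _, fun i j hij => absurd (Subsingleton.elim i j) hij,
    fwdGood_one ε w, fwdGood_one ε (flipVel w)⟩

/-- One sphere alone: the Alexander flow is free flight (forward times). [folklore] -/
theorem alexander_flow_one (ε : ℝ) {t : ℝ} (ht : 0 ≤ t) (w : Config 1 (Fin 3) T3) :
    Alexander.flow (Torus.geometry (Fin 3)) ε t w = freeFlight (Torus.geometry (Fin 3)) t w :=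
  Alexander.flow_eq_freeFlight_of_lt ht (by rw [freeExitTime_one]; exact ENNReal.ofReal_lt_top)

/-- The property of a cluster family actually used: its ONE-particle flow is free flight on an
everywhere-good set. [folklore] -/
def SingletonFree {σ : ℝ} {N : ℕ} (Ψ : ClusterFlows σ N) : Prop :=
  ∀ n, n = 1 → (Ψ n).good = Set.univ ∧
    ∀ (t : ℝ) (w : Config n (Fin 3) T3), 0 ≤ t → (Ψ n).flow t w = freeFlight (Torus.geometry (Fin 3)) t w

/-- The Alexander cluster family has the property. [folklore] -/
theorem singletonFree_alexander {σ : ℝ} {N : ℕ} (hε : 0 < hsDiameter σ N)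
    (hε' : hsDiameter σ N < 2⁻¹) :
    SingletonFree (σ := σ) (N := N) (fun k => alexanderFlow hε hε' k) := by
  rintro n rfl
  exact ⟨alexander_good_one _, fun t w ht => alexander_flow_one _ ht w⟩

/-- For a cluster of ONE sphere and a `SingletonFree` family, the isolated evolution is free
flight. [folklore] -/
theorem clusterStateIn_card_one {σ : ℝ} {N : ℕ} {Ψ : ClusterFlows σ N} (hΨ : SingletonFree Ψ)
    (S : Finset (Fin (N + 1))) (hS : S.card = 1) (m : Fin S.card) {t : ℝ} (ht : 0 ≤ t)
    (z : Config (N + 1) (Fin 3) T3) :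
    clusterStateIn Ψ S m t z = freeFlight (Torus.geometry (Fin 3)) t (Config.restrictTo S z) m := by
  obtain ⟨hg, hf⟩ := hΨ S.card hS
  unfold clusterStateIn
  rw [Set.piecewise_eq_of_mem _ _ _ (by rw [hg]; exact Set.mem_univ _), hf t _ ht]

/-- ISOLATION ⇒ the range cluster is the singleton. [folklore] -/
theorem rangeCluster_eq_singleton {N : ℕ} {r : ℝ} {z : Config (N + 1) (Fin 3) T3} {i : Fin (N + 1)}
    (hi : ∀ k, k ≠ i → r < ‖(Torus.geometry (Fin 3)).sepVec (z i).1 (z k).1‖) :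
    rangeCluster (Torus.geometry (Fin 3)) r z i = {i} := by
  ext k
  rw [mem_rangeCluster, Finset.mem_singleton]
  constructor
  · rintro (rfl | hk)
    · rfl
    · by_contra hki
      exact (not_le.2 (hi k hki)) hk
  · rintro rfl
    exact Or.inl rfl

/-- ISOLATION ⇒ the local forecast of `i` is its free flight (position translated, velocity
kept), for a `SingletonFree` family. [folklore] -/
theorem localClusterState_of_isolated {σ : ℝ} {N : ℕ} {Ψ : ClusterFlows σ N} (hΨ : SingletonFree Ψ)
    {r : ℝ} {z : Config (N + 1) (Fin 3) T3} {i : Fin (N + 1)}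
    (hi : ∀ k, k ≠ i → r < ‖(Torus.geometry (Fin 3)).sepVec (z i).1 (z k).1‖) {t : ℝ} (ht : 0 ≤ t) :
    localClusterState Ψ r t z i =
      ((Torus.geometry (Fin 3)).translate (z i).1 (t • (z i).2), (z i).2) := by
  have hcard : (rangeCluster (Torus.geometry (Fin 3)) r z i).card = 1 := by
    rw [rangeCluster_eq_singleton hi, Finset.card_singleton]
  unfold localClusterState
  rw [clusterStateIn_card_one hΨ _ hcard _ ht, freeFlight_apply, Config.restrictTo_clusterIndex]

/-- **CERTIFICATION LEMMA.** Two isolated spheres whose free flights overlap inside the window: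
at least one of them is bad. No property of `Φ` beyond the structure axioms is used. [folklore] -/
theorem one_le_badCount_of_isolated_overlap {σ T R : ℝ} {N : ℕ} (Φ : Flow σ N)
    {Ψ : ClusterFlows σ N} (hΨ : SingletonFree Ψ) {z : Config (N + 1) (Fin 3) T3}
    (hz : z ∈ Φ.good) {i j : Fin (N + 1)} (hij : i ≠ j)
    (hi : ∀ k, k ≠ i → R * ell N < ‖(Torus.geometry (Fin 3)).sepVec (z i).1 (z k).1‖)
    (hj : ∀ k, k ≠ j → R * ell N < ‖(Torus.geometry (Fin 3)).sepVec (z j).1 (z k).1‖)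
    {t : ℝ} (ht0 : 0 ≤ t) (htT : t ≤ T * ell N)
    (hchart : ‖(Torus.geometry (Fin 3)).sepVec (z i).1 (z j).1‖ + ‖t • (z i).2 - t • (z j).2‖ < 1 / 2)
    (hoverlap : ‖(Torus.geometry (Fin 3)).sepVec (z i).1 (z j).1 + (t • (z i).2 - t • (z j).2)‖ <
      hsDiameter σ N) :
    1 ≤ badCount σ T R N Φ Ψ z := by
  unfold badCount
  by_contra hlt
  have hempty : (Finset.univ.filter fun i : Fin (N + 1) => ∃ s ∈ Set.Icc (0 : ℝ) (T * ell N),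
      Φ.flow s z i ≠ localClusterState Ψ (R * ell N) s z i) = ∅ :=
    Finset.card_eq_zero.1 (by omega)
  have hgood : ∀ k, Φ.flow t z k = localClusterState Ψ (R * ell N) t z k := by
    intro k
    by_contra hne
    have hk : k ∈ (Finset.univ.filter fun i : Fin (N + 1) => ∃ s ∈ Set.Icc (0 : ℝ) (T * ell N),
        Φ.flow s z i ≠ localClusterState Ψ (R * ell N) s z i) :=
      Finset.mem_filter.2 ⟨Finset.mem_univ _, t, ⟨ht0, htT⟩, hne⟩
    rw [hempty] at hk
    exact Finset.notMem_empty _ hk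
  have hti := hgood i
  have htj := hgood j
  rw [localClusterState_of_isolated hΨ hi ht0] at hti
  rw [localClusterState_of_isolated hΨ hj ht0] at htj
  have hdom : Φ.flow t z ∈ hardSphereDomain (Torus.geometry (Fin 3)) (N + 1) (hsDiameter σ N) :=
    Φ.good_subset (Φ.mapsTo_good t hz)
  have hsep := hdom i j hij
  rw [hti, htj] at hsep
  dsimp only at hsep
  rw [Torus.sepVec_translate_of_norm_lt hchart] at hsep
  exact (not_lt.2 hsep) hoverlap

/-- `G_N ≪ Liouville` (it is `liouville.withDensity` of the canonical density). [folklore] -/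
theorem gibbs_absolutelyContinuous (σ a θ : ℝ) (u₀ : V3) (N : ℕ) (Φ : Flow σ N) :
    gibbs σ a θ u₀ N Φ ≪ liouville (Torus.geometry (Fin 3)) (N + 1) (hsDiameter σ N) := by
  unfold gibbs Literature.MathematicalPhysics.KineticTheory.localGibbsLaw
  rw [particleLaw_eq]
  exact withDensity_absolutelyContinuous _ _

/-- The junk of `Φ` off its good set is `G_N`-null. [folklore] -/
theorem gibbs_compl_good (σ a θ : ℝ) (u₀ : V3) (N : ℕ) (Φ : Flow σ N) :
    gibbs σ a θ u₀ N Φ Φ.goodᶜ = 0 :=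
  gibbs_absolutelyContinuous σ a θ u₀ N Φ Φ.measure_compl_good

/-- THE WITNESS EVENT of near-miss 1 for the pair `(i, j)`: both isolated at range `Rℓ`, and
their free flights `< ε` apart (in the chart) at the half-window time `Tℓ/2`. Open conditions on
the positions of all spheres and on the velocities of `i, j` only. [folklore] -/
def AimedPair (σ T R : ℝ) (N : ℕ) (i j : Fin (N + 1)) : Set (Config (N + 1) (Fin 3) T3) :=
  {z | (∀ k, k ≠ i → R * ell N < ‖(Torus.geometry (Fin 3)).sepVec (z i).1 (z k).1‖) ∧
    (∀ k, k ≠ j → R * ell N < ‖(Torus.geometry (Fin 3)).sepVec (z j).1 (z k).1‖) ∧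
    ‖(Torus.geometry (Fin 3)).sepVec (z i).1 (z j).1‖ +
        ‖(T * ell N / 2) • (z i).2 - (T * ell N / 2) • (z j).2‖ < 1 / 2 ∧
    ‖(Torus.geometry (Fin 3)).sepVec (z i).1 (z j).1 +
        ((T * ell N / 2) • (z i).2 - (T * ell N / 2) • (z j).2)‖ < hsDiameter σ N}

/-- The union over partners `j ≠ 0` of the witness events of the pair `(0, j)` (a disjoint
union as soon as `R ≥ 0`, by the isolation clauses). [folklore] -/
def AimedPairs (σ T R : ℝ) (N : ℕ) : Set (Config (N + 1) (Fin 3) T3) :=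
  ⋃ j ∈ {j : Fin (N + 1) | j ≠ 0}, AimedPair σ T R N 0 j

/-- Measurability of the separation of two labelled spheres. [folklore] -/
theorem measurable_sepVec_coord {N : ℕ} (i k : Fin (N + 1)) :
    Measurable fun z : Config (N + 1) (Fin 3) T3 => (Torus.geometry (Fin 3)).sepVec (z i).1 (z k).1 :=
  Torus.measurable_geometry_sepVec.comp ((measurable_pi_apply i).fst.prodMk (measurable_pi_apply k).fst)

/-- Measurability of the scaled relative velocity of two labelled spheres. [folklore] -/
theorem measurable_relVel_coord {N : ℕ} (c : ℝ) (i j : Fin (N + 1)) :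
    Measurable fun z : Config (N + 1) (Fin 3) T3 => c • (z i).2 - c • (z j).2 :=
  ((measurable_pi_apply i).snd.const_smul c).sub ((measurable_pi_apply j).snd.const_smul c)

/-- The witness event is measurable. [folklore] -/
theorem measurableSet_aimedPair (σ T R : ℝ) (N : ℕ) (i j : Fin (N + 1)) :
    MeasurableSet (AimedPair σ T R N i j) := by
  have hiso : ∀ i : Fin (N + 1), MeasurableSet {z : Config (N + 1) (Fin 3) T3 |
      ∀ k, k ≠ i → R * ell N < ‖(Torus.geometry (Fin 3)).sepVec (z i).1 (z k).1‖} := by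
    intro i
    have hset : {z : Config (N + 1) (Fin 3) T3 |
        ∀ k, k ≠ i → R * ell N < ‖(Torus.geometry (Fin 3)).sepVec (z i).1 (z k).1‖} =
        ⋂ (k : Fin (N + 1)) (_ : k ≠ i),
          {z | R * ell N < ‖(Torus.geometry (Fin 3)).sepVec (z i).1 (z k).1‖} := by
      ext z; simp only [Set.mem_setOf_eq, Set.mem_iInter]
    rw [hset]
    exact MeasurableSet.iInter fun k => MeasurableSet.iInter fun _ =>
      measurableSet_lt measurable_const (measurable_sepVec_coord i k).norm
  refine ((hiso i).inter ((hiso j).inter (MeasurableSet.inter ?_ ?_)))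
  · exact measurableSet_lt ((measurable_sepVec_coord i j).norm.add
      (measurable_relVel_coord _ i j).norm) measurable_const
  · exact measurableSet_lt ((measurable_sepVec_coord i j).add (measurable_relVel_coord _ i j)).norm
      measurable_const

/-- The union of witness events is measurable. [folklore] -/
theorem measurableSet_aimedPairs (σ T R : ℝ) (N : ℕ) : MeasurableSet (AimedPairs σ T R N) :=
  MeasurableSet.biUnion (Set.to_countable _) fun j _ => measurableSet_aimedPair σ T R N 0 j

/-- On the witness event intersected with the good set, some sphere is bad (certification
lemma at `t = Tℓ/2`). [folklore] -/
theorem one_le_badCount_of_mem_aimedPairs {σ T R : ℝ} {N : ℕ} (hT : 0 ≤ T) (Φ : Flow σ N)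
    {Ψ : ClusterFlows σ N} (hΨ : SingletonFree Ψ) {z : Config (N + 1) (Fin 3) T3}
    (hz : z ∈ AimedPairs σ T R N) (hzg : z ∈ Φ.good) : 1 ≤ badCount σ T R N Φ Ψ z := by
  simp only [AimedPairs, Set.mem_iUnion, Set.mem_setOf_eq, exists_prop] at hz
  obtain ⟨j, hj0, hiso0, hisoj, hchart, hover⟩ := hz
  have hℓ : 0 ≤ T * ell N := mul_nonneg hT (Real.rpow_nonneg (by positivity) _)
  exact one_le_badCount_of_isolated_overlap Φ hΨ hzg (Ne.symm hj0) hiso0 hisoj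
    (by positivity) (half_le_self hℓ) hchart hover

/-- The diameter `σℓ` is positive and at most `σ`. [folklore] -/
theorem hsDiameter_pos_le {σ : ℝ} (hσ : 0 < σ) (N : ℕ) :
    0 < hsDiameter σ N ∧ hsDiameter σ N ≤ σ := by
  unfold hsDiameter
  have h1 : (1 : ℝ) ≤ ((N + 1 : ℕ) : ℝ) := by exact_mod_cast Nat.succ_le_succ (Nat.zero_le N)
  refine ⟨mul_pos hσ (Real.rpow_pos_of_pos (by positivity) _), ?_⟩
  calc σ * ((N + 1 : ℕ) : ℝ) ^ (-(1 / 3 : ℝ)) ≤ σ * 1 :=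
        mul_le_mul_of_nonneg_left (Real.rpow_le_one_of_one_le_of_nonpos h1 (by norm_num)) hσ.le
    _ = σ := mul_one σ

end Certification

/-- REDUCTION of the dynamical fact `CorruptionEvent` to a static mass bound on the witness event
(flows := Alexander's, event := `AimedPairs ∩ good`). [folklore] -/
theorem corruptionEvent_of_aimedPairs_mass {σ T R : ℝ} (hσ : 0 < σ) (hσ' : σ ≤ 1 / 4)
    (hT : 0 < T)
    (hmass : ∃ p : ℝ≥0∞, 0 < p ∧ ∃ N₀ : ℕ, ∀ N : ℕ, N₀ ≤ N → ∀ Φ : Flow σ N,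
      p ≤ gibbs σ 1 1 0 N Φ (AimedPairs σ T R N)) :
    CorruptionEvent 1 1 0 σ T R := by
  obtain ⟨p, hp, N₀, hN⟩ := hmass
  refine ⟨p, hp, N₀, fun N hN₀ => ?_⟩
  obtain ⟨hε, hεσ⟩ := hsDiameter_pos_le hσ N
  have hε' : hsDiameter σ N < 2⁻¹ := hεσ.trans_lt (hσ'.trans_lt (by norm_num))
  refine ⟨alexanderFlow hε hε' (N + 1), fun k => alexanderFlow hε hε' k,
    AimedPairs σ T R N ∩ (alexanderFlow hε hε' (N + 1)).good,
    (measurableSet_aimedPairs σ T R N).inter (alexanderFlow hε hε' (N + 1)).measurableSet_good,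
    fun z hz => one_le_badCount_of_mem_aimedPairs hT.le _ (singletonFree_alexander hε hε') hz.1 hz.2,
    ?_⟩
  rw [measure_inter_conull (gibbs_compl_good σ 1 1 0 N _)]
  exact hN N hN₀ _

end

end Summit.AtomisticToContinuum.HydrodynamicLimit.Theorems.InfluenceLocality.Negative
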